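import Summits.HubbardSuperconductivity.HubbardLadder.NeelSignOddAxisUniform
import HarnessLib

/-!
# Explicit GEOMETRIC margins on the whole odd axis: `c_L(0, 2M+1) ≤ -(1/8)·(17/1250)^M` for every `M ≥ 1` and every even `L ≥ 2M+2` (HubbardLadder R2, device D53-K3)

HONEST FRAMING: ladder R1–R4 with certified numbers; no claim on H/H₀.  Reference model only: the spin-½
Heisenberg antiferromagnet on the even torus `(ℤ/Lℤ)²`, `c_L(a,b) = heisRedCorr2 L 1 a b`; WEAK sign statements
at tiny margins, uniform in `L` — not Néel order, nothing about the Hubbard model.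

`NeelSignOddAxisUniform.lean` (D53-K1) runs the reflection-positivity minors as a recursion that SQUARES the margin at
each step (`q ↦ 4q²`, doubly-exponential decay, margins existential).  The same minors give more when chained
ADJACENTLY: with `u_i := -c_L(2i+1, 0) ≥ 0` (Marshall sign) the two-row minor on rows `{i-1, i+1}`
(`heis_rpTwoRowMinor_axis`) is `u_{i-1}·u_{i+1} ≥ u_i²` — the sequence `u_0, u_1, u_2, …` is LOG-CONVEX
(it is a moment sequence of the reflection-positive transfer operator, Dyson–Lieb–Simon Thm 4.2 /
Kennedy–Lieb–Shastry eq. (25)), hence `u_{i+1}/u_i ≥ u_i/u_{i-1} ≥ … ≥ u_1/u_0` and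
`u_M ≥ u_0·(u_1/u_0)^M = u_1^M / u_0^{M-1}`.  Feeding the landed rows `u_1 = -c_L(0,3) ≥ 17/10⁴`
(`heisRedCorr2_C03_ceiling_allEven`, every even `L ≥ 4`), `u_0 = -c_L(0,1) ≤ 1/8` (Anderson's floor
`heisRedCorr2_C01_floor`) and `u_0 ≥ 1/12` (`heisRedCorr2_C01_ceiling_allEven`, positivity of the chain) gives the
CLOSED FORM `c_L(0,2M+1) ≤ -(1/8)·(17/1250)^M` for all `M ≥ 1`, even `L ≥ 2M+2` (`heisRedCorr2_oddAxis_geometric`):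
`M = 1`: `-17/10⁴` (the source), `M = 2`: `-2.31·10⁻⁵` (= the landed `(0,5)` row `heisRedCorr2_C05_ceiling_allEven`,
`23/10⁶`), `M = 3`: `-3.1·10⁻⁷` (the landed `(0,7)` row has `2·10⁻⁹`), `M = 4`: `-4.3·10⁻⁹` (landed `(0,9)`: `4·10⁻⁹`);
ratio `17/1250 = 0.0136` per step instead of squaring.  STRUCTURE.md §1A C7 thereby reads: the odd-axis margins of
record are instances of ONE log-convexity law with an explicit geometric rate.  Everything is proved; no named facts,
no numerical input, zero kit.  COUNT +0 (the cells are those of K1 / rows UK05–UK09; only constants change).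
[cite: DLS1978, Theorem 4.2] [cite: KLS1988JSP, eq. (25)] [cite: Anderson1951, eq. (4)]
-/

noncomputable section

namespace Summit.HubbardSuperconductivity.HubbardLadder

open Finset Literature.MathematicalPhysics.QuantumLattice Literature.Probability.LatticeModels

/-- **Log-convexity step of the odd-axis moments.**  On the torus of side `2k`, with `u_i := -c(2i+1, 0)`:
if `0 < u_j` then `u_{j+1}² ≤ u_j · u_{j+2}` (rows `{j, j+2}` of the reflection-positivity Gram form, `j + 2 < k`).
[cite: DLS1978, Theorem 4.2] [cite: KLS1988JSP, eq. (25)] -/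
theorem heisRedCorr2_oddAxis_logConvex (k j : ℕ) (hj : j + 2 < k)
    (hpos : haveI : NeZero (2 * k) := ⟨by omega⟩; 0 < -heisRedCorr2 (2 * k) 1 (2 * j + 1) 0) :
    haveI : NeZero (2 * k) := ⟨by omega⟩
    (-heisRedCorr2 (2 * k) 1 (2 * (j + 1) + 1) 0) ^ 2 ≤
      -heisRedCorr2 (2 * k) 1 (2 * j + 1) 0 * -heisRedCorr2 (2 * k) 1 (2 * (j + 2) + 1) 0 := by
  haveI : NeZero (2 * k) := ⟨by omega⟩
  have hq := heis_rpTwoRowMinor_axis k j (j + 2) (by omega) (by omega) hj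
    (-heisRedCorr2 (2 * k) 1 (2 * (j + 1) + 1) 0) (-(-heisRedCorr2 (2 * k) 1 (2 * j + 1) 0))
  have e : j + (j + 2) + 1 = 2 * (j + 1) + 1 := by ring
  rw [e] at hq
  -- `hq : 0 ≤ u_j · (u_j u_{j+2} - u_{j+1}²)` after expansion; cancel `u_j > 0`
  refine le_of_mul_le_mul_left ?_ hpos
  nlinarith [hq]

/-- **Explicit geometric margins on the whole odd axis** (STRUCTURE.md §1A C7 as ONE closed-form law): for every
`M ≥ 1` and every even `L ≥ 2M + 2`, `c_L(0, 2M+1) ≤ -(1/8)·(17/1250)^M`.  Proof: log-convexity of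
`u_i = -c_L(2i+1,0)` (`heisRedCorr2_oddAxis_logConvex`) ⇒ `u_{i+1} ≥ (u_1/u_0)·u_i ≥ (17/10⁴)/(1/8)·u_i = (17/1250)·u_i`,
started at `u_1 ≥ 17/10⁴ = (1/8)(17/1250)`.  A WEAK, `L`-uniform SIGN statement with an explicit (tiny, geometric)
margin; not Néel order.  HONEST FRAMING: ladder R1–R4 with certified numbers; no claim on H/H₀.
[cite: DLS1978, Theorem 4.2] [cite: KLS1988JSP, eq. (25)] [cite: Anderson1951, eq. (4)] -/
theorem heisRedCorr2_oddAxis_geometric (M L : ℕ) (hM : 1 ≤ M) (hL : 2 * M + 2 ≤ L) (hev : Even L) :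
    haveI : NeZero L := ⟨by omega⟩
    heisRedCorr2 L 1 0 (2 * M + 1) ≤ -((1 / 8 : ℝ) * (17 / 1250) ^ M) := by
  obtain ⟨k, hk⟩ := hev
  have hk2 : L = 2 * k := by omega
  subst hk2
  haveI : NeZero (2 * k) := ⟨by omega⟩
  have hkM : M + 1 ≤ k := by omega
  -- the moment sequence and its two anchors
  set u : ℕ → ℝ := fun i => -heisRedCorr2 (2 * k) 1 (2 * i + 1) 0 with hu
  have hu0le : u 0 ≤ 1 / 8 := by
    have h := heisRedCorr2_C01_floor (2 * k) (by omega)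
    rw [heisRedCorr2_swap (2 * k) 1 0 1] at h
    simp only [hu]
    linarith
  have hu0pos : 0 < u 0 := by
    have h := heisRedCorr2_C01_ceiling_allEven (2 * k) (by omega) (even_two_mul k)
    rw [heisRedCorr2_swap (2 * k) 1 0 1] at h
    simp only [hu]
    linarith
  have hu1 : (17 / 10000 : ℝ) ≤ u 1 := by
    have h := heisRedCorr2_C03_ceiling_allEven (2 * k) (by omega) (even_two_mul k)
    rw [heisRedCorr2_swap (2 * k) 1 0 3] at h
    simp only [hu]
    linarith
  have hu1pos : 0 < u 1 := lt_of_lt_of_le (by norm_num) hu1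
  -- ratio chain: positivity and `u_1 · u_j ≤ u_0 · u_{j+1}` for `j + 1 ≤ M`
  have chain : ∀ j : ℕ, j + 1 ≤ M → 0 < u j ∧ u 1 * u j ≤ u 0 * u (j + 1) := by
    intro j
    induction j with
    | zero => intro _; exact ⟨hu0pos, le_of_eq (mul_comm _ _)⟩
    | succ j ih =>
      intro hjM
      obtain ⟨hposj, hratj⟩ := ih (by omega)
      have hposj1 : 0 < u (j + 1) := by
        have h1 : 0 < u 0 * u (j + 1) := lt_of_lt_of_le (mul_pos hu1pos hposj) hratj
        exact (pos_iff_pos_of_mul_pos h1).mp hu0pos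
      refine ⟨hposj1, ?_⟩
      -- log-convexity at rows `{j, j+2}` (needs `j + 2 < k`, from `j + 2 ≤ M < k`)
      have hlc : u (j + 1) ^ 2 ≤ u j * u (j + 2) := by
        have h := heisRedCorr2_oddAxis_logConvex k j (by omega) (by simpa [hu] using hposj)
        simpa [hu] using h
      have h2 : u j * (u 1 * u (j + 1)) ≤ u j * (u 0 * u (j + 1 + 1)) := by
        have e : j + 1 + 1 = j + 2 := by ring
        rw [e]
        nlinarith [hlc, hratj, hposj.le, hposj1.le, hu0pos.le]
      exact le_of_mul_le_mul_left h2 hposj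
  -- geometric growth of the lower bound: `(1/8)(17/1250)^j ≤ u_j` for `1 ≤ j ≤ M`
  have geom : ∀ j : ℕ, 1 ≤ j → j ≤ M → (1 / 8 : ℝ) * (17 / 1250) ^ j ≤ u j := by
    intro j
    induction j with
    | zero => intro h; exact absurd h (by omega)
    | succ j ih =>
      intro _ hjM
      rcases Nat.eq_zero_or_pos j with hj0 | hjpos
      · subst hj0
        norm_num
        linarith [hu1]
      · have hprev := ih hjpos (by omega)
        obtain ⟨hposj, hratj⟩ := chain j (by omega)
        have hposj1 : 0 ≤ u (j + 1) := by
          have h1 : 0 < u 0 * u (j + 1) := lt_of_lt_of_le (mul_pos hu1pos hposj) hratj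
          exact ((pos_iff_pos_of_mul_pos h1).mp hu0pos).le
        -- `u_0 u_{j+1} ≥ u_1 u_j ≥ (17/10⁴) u_j` and `u_0 ≤ 1/8`
        have hstep : (17 / 1250 : ℝ) * u j ≤ u (j + 1) := by
          nlinarith [hratj, hu1, hu0le, hposj.le, hposj1]
        have hc : (0 : ℝ) ≤ 17 / 1250 := by norm_num
        calc (1 / 8 : ℝ) * (17 / 1250) ^ (j + 1)
            = (17 / 1250) * ((1 / 8 : ℝ) * (17 / 1250) ^ j) := by ring
          _ ≤ (17 / 1250) * u j := mul_le_mul_of_nonneg_left hprev hc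
          _ ≤ u (j + 1) := hstep
  have hM' := geom M hM le_rfl
  rw [heisRedCorr2_swap (2 * k) 1 0 (2 * M + 1)]
  simp only [hu] at hM'
  linarith

/-- The same law on the other axis: `c_L(2M+1, 0) ≤ -(1/8)·(17/1250)^M` (`M ≥ 1`, even `L ≥ 2M+2`).
HONEST FRAMING: ladder R1–R4 with certified numbers; no claim on H/H₀. [cite: DLS1978, Theorem 4.2] [cite: KLS1988JSP, eq. (25)] -/
theorem heisRedCorr2_oddAxis_geometric_swap (M L : ℕ) (hM : 1 ≤ M) (hL : 2 * M + 2 ≤ L) (hev : Even L) :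
    haveI : NeZero L := ⟨by omega⟩
    heisRedCorr2 L 1 (2 * M + 1) 0 ≤ -((1 / 8 : ℝ) * (17 / 1250) ^ M) := by
  haveI : NeZero L := ⟨by omega⟩
  rw [heisRedCorr2_swap L 1 (2 * M + 1) 0]
  exact heisRedCorr2_oddAxis_geometric M L hM hL hev

/-- **Instance `M = 3`: `c_L(0,7) ≤ -4913/15625000000 ≈ -3.1·10⁻⁷` for every even `L ≥ 8`** — the `(0,7)` cell
with the geometric constant (`(1/8)(17/1250)³`; the row of record `heisRedCorr2_C07_ceiling_allEven` has `2·10⁻⁹`).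
COUNT +0 (same cell).  HONEST FRAMING: ladder R1–R4 with certified numbers; no claim on H/H₀.
[cite: DLS1978, Theorem 4.2] [cite: KLS1988JSP, eq. (25)] -/
theorem heisRedCorr2_C07_ceiling_geometric (L : ℕ) (hL : 8 ≤ L) (hev : Even L) :
    haveI : NeZero L := ⟨by omega⟩
    heisRedCorr2 L 1 0 7 ≤ -(4913 / 15625000000 : ℝ) := by
  have h := heisRedCorr2_oddAxis_geometric 3 L (by norm_num) (by omega) hev
  norm_num at h ⊢
  linarith

/-- **Instance `M = 4`: `c_L(0,9) ≤ -83521/19531250000000 ≈ -4.28·10⁻⁹` for every even `L ≥ 10`**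
(`(1/8)(17/1250)⁴`; row of record `heisRedCorr2_C09_ceiling_allEven`: `4·10⁻⁹`).  COUNT +0 (same cell).
HONEST FRAMING: ladder R1–R4 with certified numbers; no claim on H/H₀. [cite: DLS1978, Theorem 4.2] [cite: KLS1988JSP, eq. (25)] -/
theorem heisRedCorr2_C09_ceiling_geometric (L : ℕ) (hL : 10 ≤ L) (hev : Even L) :
    haveI : NeZero L := ⟨by omega⟩
    heisRedCorr2 L 1 0 9 ≤ -(83521 / 19531250000000 : ℝ) := by
  have h := heisRedCorr2_oddAxis_geometric 4 L (by norm_num) (by omega) hev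
  norm_num at h ⊢
  linarith

end Summit.HubbardSuperconductivity.HubbardLadder

end
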